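import Summits.QuantumFields.BalabanUV.Beta.FP.ConstrainedBiLaplacianFibreOperator
import Literature.MathematicalPhysics.QuantumFieldTheory.Balaban1983to89.B4Green244

/-!
# `BalabanUV.Beta.FP.ConstrainedBiLaplacianPairing` — road «FP» for binder row D1, row **RHOA-4-GH (localisation half)**, the n-UNIFORM
# currency: FILE 4c — THE PAIRING MULTIPLIER `Φ_{f,g} = Σ_{τσ} conj(f τ)·g σ·M n s τ σ` IS STRIP-REGULAR WITH THE n-FREE BOUND
# `4^d·Kop·‖f‖₂‖g‖₂`, HENCE THE BLOCK-PAIR MATRICES OF THE CONSTRAINED INVERSE OF `(Δ^ξ)^s` DECAY IN OPERATOR NORM LIKE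
# `4^{d+1}·Kop·e^{−kappaB·|x⁰−y⁰|_∞}`, UNIFORMLY IN `n ≥ 1`

NOT IN PRINT; OUR PROOF ATTEMPT (binder row G-an2-4 ∕ (CONV-C), prover part P3, fibre∕strip lineage).  HONEST DEPENDENCY (cell records,
verbatim): «continuum YM on T⁴ ⇐ BetaPertH ∧ nine spine estimates (0/9 proved); BetaPertH ⇐ (D1) ∧ (D4) ∧ CAP+tail; G-an2-4 gates asym, D1
and NE2/3/4.»  HONEST FRAMING (cell contract, verbatim): «discharging `BetaPertH` makes Bałaban's UV stability UNCONDITIONAL — a real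
constructive-QFT result; it is NOT the continuum limit and NOT the Clay problem.»  ABSOLUTE RULE (cell charter, verbatim): «No internally-minted
statement may enter as a cited fact. Every hypothesis is either kernel-proved in this package or a verbatim quotation of a PUBLISHED theorem with
page reference. The manuscript(s) under audit are NOT citable for their own disputed steps — they are the thing under adjudication;
programme-internal (2001/route/tribunal) claims are never citable.»  THIS MODULE is [folklore] analysis over FILES 1–3b, 4a, 4b of the row and `B4ContourShift`∕`B4Green244` (`latticeKernel_decay`,
`latticeKernel_sum_mul`); no symbol of [B4] is re-defined, nothing is cited as a hypothesis, no `def … : Prop`, no `sorry`.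


v1.1 (gen 22, DOCSTRING-ONLY — no declaration changed): a size-of-constants sentence on `pairing_decay_uniform` (INFO-1∕2 of the cross-read
C-gan24leaf03-g46).
## The statement

With `M n s τ σ` the offset-pair multiplier of FILE 3b (the fine-lattice kernel entry `((x⁰,τ),(y⁰,σ))` of the inverse of `(Δ^ξ)^s` compressed
to `ker Q′` is `latticeKernel (M n s τ σ) (x⁰−y⁰)`; dictionary FILE 2a §0) and offset vectors `f, g`:
`Phi n s f g = Σ_{τσ} conj(f τ)·g σ·M n s τ σ = n^{−d}Σ_{kk′} Adft f k·Bdft g k′·Gfib k k′` (`Phi_eq_dft`); FILE 4a's Parseval (`n^d·4^d`) against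
the `n^{−d}` and FILE 4b's operator bound give **`norm_Phi_le : ‖Phi n s f g p′‖ ≤ 4^d·Kop d s·√(sqNorm f)·√(sqNorm g)`** on
`Strip d (kappaB d s)` for EVERY `n ≥ 1`; with the side periodicity of `M` this is `StripRegular` (`stripRegular_Phi`), and
`B4ContourShift.latticeKernel_decay` yields **`pairing_decay`**:
`‖Σ_{τσ} conj(f τ)·g σ·latticeKernel (M n s τ σ) x‖ ≤ 4^{d+1}·Kop (d+1) s·√(sqNorm f)·√(sqNorm g)·e^{−kappaB (d+1) s·|x|_∞}`, all `n ≥ 1` —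
the OPERATOR norm of the block-pair matrix decays on the block scale with n-FREE rate AND prefactor (`pairing_decay_uniform`).  In unit-lattice
currency (`× n^{2s}`) this is the `n⁴·e^{−κ·d_∞(B,B′)}` statement for the ghost's bi-Laplacian that R-FP-29 asked for, prefactor = the gap
half's.  REMAINING for the row as the consumer reads it (honest): the background-field dependence (B-jets) and the torus periodisation.

## Contents

* §1 `Phi`, `sum4_comm`, **`Phi_eq_dft`**, **`norm_Phi_le`**, `differentiableAt_Phi`, `Phi_tr_side`.
* §2 (dimension `d+1`) **`stripRegular_Phi`**, `latticeKernel_Phi`, **`pairing_decay`**, `pairing_decay_uniform`, and the indicator corollary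
  **`entry_decay_uniform`** (`‖latticeKernel (M n s τ σ) x‖ ≤ 4^{d+1}·Kop·e^{−kappaB|x|_∞}`, n-FREE — in block units even single entries are n-uniform).

0∕4 row-D1 binders touched.  NOT RHOA-4-GH as the consumer reads it (B-jets, torus), NOT hbook, NOT D1, NOT BetaPertH, NOT continuum, NOT Clay.
Provenance: prover-b2b-balaban-gan24-p3-g21-0 (unit `b2b-balaban-gan24-p3`, gen 21; R-FP-29 ∕ R-FP-33 (b)), 2026-08-21.
-/

noncomputable section

namespace Summit.QuantumFields.BalabanUV.Beta.FP.ConstrainedBiLaplacianPairing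

open Complex Finset ComplexConjugate
open Literature.MathematicalPhysics.QuantumFieldTheory.Balaban1983to89
open Literature.MathematicalPhysics.QuantumFieldTheory.Balaban1983to89.B4Strip
open Literature.MathematicalPhysics.QuantumFieldTheory.Balaban1983to89.B4StripCauchy
open Literature.MathematicalPhysics.QuantumFieldTheory.Balaban1983to89.B5Strip145Analytic
open Literature.MathematicalPhysics.QuantumFieldTheory.Balaban1983to89.B4StripSums
open Summit.QuantumFields.BalabanUV.Beta.FP.ConstrainedBiLaplacianStrip
open Summit.QuantumFields.BalabanUV.Beta.FP.ConstrainedBiLaplacianFibre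
open Summit.QuantumFields.BalabanUV.Beta.FP.ConstrainedBiLaplacianFibreEntries
open Summit.QuantumFields.BalabanUV.Beta.FP.ConstrainedBiLaplacianFibreSides
open Summit.QuantumFields.BalabanUV.Beta.FP.ConstrainedBiLaplacianKernel
open scoped Real
open Summit.QuantumFields.BalabanUV.Beta.FP.ConstrainedBiLaplacianParseval
open Summit.QuantumFields.BalabanUV.Beta.FP.ConstrainedBiLaplacianFibreOperator

variable {d : ℕ}

/-! ## §1 The pairing multiplier -/

/-- [folklore] **THE PAIRING MULTIPLIER** `Phi n s f g p = Σ_{τσ} conj(f τ)·g σ·M n s τ σ p` — the multiplier of the block-pair pairing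
`⟨f, 𝒢(x⁰,y⁰) g⟩ = Σ_{τσ} conj(f τ) g σ 𝒢((x⁰,τ),(y⁰,σ))`. -/
def Phi (n : ℕ) [NeZero n] (s : ℕ) (f g : (Fin d → Fin n) → ℂ) (p : Fin d → ℂ) : ℂ :=
  ∑ τ : Fin d → Fin n, ∑ σ : Fin d → Fin n, conj (f τ) * g σ * M n s τ σ p

/-- [folklore] Commuting a quadruple sum: `Σ_a Σ_b Σ_c Σ_e = Σ_c Σ_e Σ_a Σ_b`. -/
theorem sum4_comm {α β γ δ : Type*} [Fintype α] [Fintype β] [Fintype γ] [Fintype δ] (G : α → β → γ → δ → ℂ) :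
    ∑ a, ∑ b, ∑ c, ∑ e, G a b c e = ∑ c, ∑ e, ∑ a, ∑ b, G a b c e := by
  calc ∑ a, ∑ b, ∑ c, ∑ e, G a b c e = ∑ a, ∑ c, ∑ b, ∑ e, G a b c e :=
        Finset.sum_congr rfl fun a _ => Finset.sum_comm
    _ = ∑ c, ∑ a, ∑ b, ∑ e, G a b c e := Finset.sum_comm
    _ = ∑ c, ∑ a, ∑ e, ∑ b, G a b c e :=
        Finset.sum_congr rfl fun c _ => Finset.sum_congr rfl fun a _ => Finset.sum_comm
    _ = ∑ c, ∑ e, ∑ a, ∑ b, G a b c e := Finset.sum_congr rfl fun c _ => Finset.sum_comm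

/-- [folklore] **THE PAIRING IN DFT VARIABLES**: `Phi = ((n:ℂ)^d)⁻¹ Σ_{kk′} Adft f k · Bdft g k′ · Gfib k k′`. -/
theorem Phi_eq_dft (n : ℕ) [NeZero n] (s : ℕ) (f g : (Fin d → Fin n) → ℂ) (p : Fin d → ℂ) :
    Phi n s f g p = ((n : ℂ) ^ d)⁻¹ * ∑ k : Fin d → Fin n, ∑ k' : Fin d → Fin n, Adft n f k p * Bdft n g k' p * Gfib n s k k' p := by
  have lhs : Phi n s f g p = ∑ τ : Fin d → Fin n, ∑ σ : Fin d → Fin n, ∑ k : Fin d → Fin n, ∑ k' : Fin d → Fin n,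
      conj (f τ) * g σ * (((n : ℂ) ^ d)⁻¹ * (EF n τ k p * EFc n σ k' p * Gfib n s k k' p)) := by
    unfold Phi M
    refine Finset.sum_congr rfl fun τ _ => Finset.sum_congr rfl fun σ _ => ?_
    rw [Finset.mul_sum, Finset.mul_sum]
    refine Finset.sum_congr rfl fun k _ => ?_
    rw [Finset.mul_sum, Finset.mul_sum]
  have rhs : ((n : ℂ) ^ d)⁻¹ * ∑ k : Fin d → Fin n, ∑ k' : Fin d → Fin n, Adft n f k p * Bdft n g k' p * Gfib n s k k' p
      = ∑ k : Fin d → Fin n, ∑ k' : Fin d → Fin n, ∑ τ : Fin d → Fin n, ∑ σ : Fin d → Fin n,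
        conj (f τ) * g σ * (((n : ℂ) ^ d)⁻¹ * (EF n τ k p * EFc n σ k' p * Gfib n s k k' p)) := by
    unfold Adft Bdft
    rw [Finset.mul_sum]
    refine Finset.sum_congr rfl fun k _ => ?_
    rw [Finset.mul_sum]
    refine Finset.sum_congr rfl fun k' _ => ?_
    rw [Finset.sum_mul_sum, Finset.sum_mul, Finset.mul_sum]
    refine Finset.sum_congr rfl fun τ _ => ?_
    rw [Finset.sum_mul, Finset.mul_sum]
    refine Finset.sum_congr rfl fun σ _ => ?_
    ring
  rw [lhs, rhs, sum4_comm]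

/-- [folklore] **THE n-FREE BOUND OF THE PAIRING MULTIPLIER ON THE STRIP**: for every `n ≥ 1`, `p′ ∈ Strip d (kappaB d s)` and offset vectors
`f, g`: `‖Phi n s f g p′‖ ≤ 4^d·Kop d s·√(sqNorm f)·√(sqNorm g)` — the factors `n^{−d}` of `M` and `n^{d}` of Parseval cancel. -/
theorem norm_Phi_le (n : ℕ) [NeZero n] (s : ℕ) (f g : (Fin d → Fin n) → ℂ) {p : Fin d → ℂ} (hp : p ∈ Strip d (kappaB d s)) :
    ‖Phi n s f g p‖ ≤ 4 ^ d * Kop d s * (Real.sqrt (sqNorm f) * Real.sqrt (sqNorm g)) := by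
  have hfat : p ∈ Fat d (rOf d) := strip_subset_fat (rOf_pos d).le (kappaB_le_rOf d s) hp
  have him : ∀ ν, |(p ν).im| ≤ 1 / 2 := fun ν => by linarith [(hfat ν).2, rOf_le d]
  have hn : (0 : ℝ) < (n : ℝ) ^ d := by
    have : (0 : ℝ) < n := by exact_mod_cast Nat.pos_of_ne_zero (NeZero.ne n)
    positivity
  have hA := sqNorm_Adft_le n f him
  have hB := sqNorm_Bdft_le n g him
  have hK := Kop_nonneg d s
  have hG := norm_sum_Gfib_le (n := n) (s := s) hp (fun k => Adft n f k p) (fun k' => Bdft n g k' p)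
  rw [Phi_eq_dft, norm_mul, norm_inv, norm_pow, Complex.norm_natCast]
  have hsA : Real.sqrt (sqNorm fun k => Adft n f k p) ≤ Real.sqrt ((n : ℝ) ^ d * 4 ^ d) * Real.sqrt (sqNorm f) := by
    rw [← Real.sqrt_mul (by positivity)]; exact Real.sqrt_le_sqrt hA
  have hsB : Real.sqrt (sqNorm fun k => Bdft n g k p) ≤ Real.sqrt ((n : ℝ) ^ d * 4 ^ d) * Real.sqrt (sqNorm g) := by
    rw [← Real.sqrt_mul (by positivity)]; exact Real.sqrt_le_sqrt hB
  have hsq : Real.sqrt ((n : ℝ) ^ d * 4 ^ d) * Real.sqrt ((n : ℝ) ^ d * 4 ^ d) = (n : ℝ) ^ d * 4 ^ d :=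
    Real.mul_self_sqrt (by positivity)
  calc ((n : ℝ) ^ d)⁻¹ * ‖∑ k : Fin d → Fin n, ∑ k' : Fin d → Fin n, Adft n f k p * Bdft n g k' p * Gfib n s k k' p‖
      ≤ ((n : ℝ) ^ d)⁻¹ * (Kop d s * (Real.sqrt (sqNorm fun k => Adft n f k p) * Real.sqrt (sqNorm fun k => Bdft n g k p))) :=
        mul_le_mul_of_nonneg_left hG (by positivity)
    _ ≤ ((n : ℝ) ^ d)⁻¹ * (Kop d s * ((Real.sqrt ((n : ℝ) ^ d * 4 ^ d) * Real.sqrt (sqNorm f)) *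
          (Real.sqrt ((n : ℝ) ^ d * 4 ^ d) * Real.sqrt (sqNorm g)))) :=
        mul_le_mul_of_nonneg_left (mul_le_mul_of_nonneg_left
          (mul_le_mul hsA hsB (Real.sqrt_nonneg _) (by positivity)) hK) (by positivity)
    _ = 4 ^ d * Kop d s * (Real.sqrt (sqNorm f) * Real.sqrt (sqNorm g)) := by
        have e : (Real.sqrt ((n : ℝ) ^ d * 4 ^ d) * Real.sqrt (sqNorm f)) * (Real.sqrt ((n : ℝ) ^ d * 4 ^ d) * Real.sqrt (sqNorm g))
            = ((n : ℝ) ^ d * 4 ^ d) * (Real.sqrt (sqNorm f) * Real.sqrt (sqNorm g)) := by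
          calc (Real.sqrt ((n : ℝ) ^ d * 4 ^ d) * Real.sqrt (sqNorm f)) * (Real.sqrt ((n : ℝ) ^ d * 4 ^ d) * Real.sqrt (sqNorm g))
              = (Real.sqrt ((n : ℝ) ^ d * 4 ^ d) * Real.sqrt ((n : ℝ) ^ d * 4 ^ d)) * (Real.sqrt (sqNorm f) * Real.sqrt (sqNorm g)) := by
                ring
            _ = ((n : ℝ) ^ d * 4 ^ d) * (Real.sqrt (sqNorm f) * Real.sqrt (sqNorm g)) := by rw [hsq]
        rw [e]
        field_simp

/-- [folklore] `Phi n s f g` is holomorphic (jointly) at every point of the strip. -/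
theorem differentiableAt_Phi (n : ℕ) [NeZero n] (s : ℕ) (f g : (Fin d → Fin n) → ℂ) {p : Fin d → ℂ} (hp : p ∈ Strip d (kappaB d s)) :
    DifferentiableAt ℂ (Phi n s f g) p := by
  show DifferentiableAt ℂ (fun q => ∑ τ : Fin d → Fin n, ∑ σ : Fin d → Fin n, conj (f τ) * g σ * M n s τ σ q) p
  apply DifferentiableAt.fun_sum; intro τ _
  apply DifferentiableAt.fun_sum; intro σ _
  exact (differentiableAt_M n s τ σ hp).const_mul _

/-- [folklore] Side periodicity of the pairing multiplier (from `M_tr_side`). -/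
theorem Phi_tr_side (n : ℕ) [NeZero n] (s : ℕ) (f g : (Fin d → Fin n) → ℂ) {κ : ℝ} (hκ0 : 0 ≤ κ) (hκ : κ ≤ kappaB d s)
    {p : Fin d → ℂ} (hp : p ∈ Strip d κ) (μ : Fin d) (hre : (p μ).re = -Real.pi) : Phi n s f g (tr p μ) = Phi n s f g p := by
  unfold Phi
  refine Finset.sum_congr rfl fun τ _ => Finset.sum_congr rfl fun σ _ => ?_
  rw [M_tr_side n s hκ0 hκ hp μ hre]

/-! ## §2 The n-UNIFORM block-pair decay (dimension `d+1`) -/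

open Literature.MathematicalPhysics.QuantumFieldTheory.Balaban1983to89.B4ContourShift
open Literature.MathematicalPhysics.QuantumFieldTheory.Balaban1983to89.B5Strip145Decay
open Literature.MathematicalPhysics.QuantumFieldTheory.Balaban1983to89.B4Green244 (latticeKernel_sum_mul)

/-- [folklore] **STRIP REGULARITY OF THE PAIRING MULTIPLIER** with the n-FREE bound `4^{d+1}·Kop (d+1) s·√(sqNorm f)·√(sqNorm g)`. -/
theorem stripRegular_Phi (n : ℕ) [NeZero n] (s : ℕ) (f g : (Fin (d + 1) → Fin n) → ℂ) :
    StripRegular (d := d) (Phi n s f g) (kappaB (d + 1) s)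
      (4 ^ (d + 1) * Kop (d + 1) s * (Real.sqrt (sqNorm f) * Real.sqrt (sqNorm g))) := by
  have hκ0 : 0 ≤ kappaB (d + 1) s := (kappaB_pos (d + 1) s).le
  have hdiffAt : ∀ p ∈ Strip (d + 1) (kappaB (d + 1) s), DifferentiableAt ℂ (Phi n s f g) p :=
    fun p hp => differentiableAt_Phi n s f g hp
  refine ⟨?_, ?_, ?_, ?_⟩
  · exact fun p hp => (hdiffAt p hp).continuousAt.continuousWithinAt
  · intro i q hq z hz
    have hP : i.insertNth z (ofRealVec q) ∈ Strip (d + 1) (kappaB (d + 1) s) :=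
      insertNth_mem_Strip hκ0 i hq (openRect_subset_closedRect _ hz)
    exact ((hdiffAt _ hP).comp z (differentiableAt_insertNth i _ z)).differentiableWithinAt
  · intro i q hq y hy
    obtain ⟨hP, hre⟩ := insertNth_left_mem hκ0 i hq hy
    rw [← tr_insertNth_left]
    exact (Phi_tr_side n s f g hκ0 le_rfl hP i hre).symm
  · intro p hp
    exact norm_Phi_le n s f g hp

/-- [folklore] **THE PAIRING OF THE KERNELS IS THE KERNEL OF THE PAIRING**: `Σ_{τσ} conj(f τ)·g σ·latticeKernel (M n s τ σ) x =
latticeKernel (Phi n s f g) x` (linearity of the lattice kernel; integrability from `stripRegular_M`). -/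
theorem latticeKernel_Phi (n : ℕ) [NeZero n] (s : ℕ) (f g : (Fin (d + 1) → Fin n) → ℂ) (x : Fin (d + 1) → ℤ) :
    latticeKernel (Phi n s f g) x
      = ∑ τ : Fin (d + 1) → Fin n, ∑ σ : Fin (d + 1) → Fin n, conj (f τ) * g σ * latticeKernel (M n s τ σ) x := by
  have hκ0 : 0 ≤ kappaB (d + 1) s := (kappaB_pos (d + 1) s).le
  have e : Phi n s f g = fun P => ∑ ts : (Fin (d + 1) → Fin n) × (Fin (d + 1) → Fin n),
      (conj (f ts.1) * g ts.2) * M n s ts.1 ts.2 P := by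
    funext P
    unfold Phi
    exact (Fintype.sum_prod_type' (fun τ σ => conj (f τ) * g σ * M n s τ σ P)).symm
  have key := latticeKernel_sum_mul (Finset.univ : Finset ((Fin (d + 1) → Fin n) × (Fin (d + 1) → Fin n)))
    (fun ts => conj (f ts.1) * g ts.2) (fun ts P => M n s ts.1 ts.2 P) x
    (fun ts _ => (stripRegular_M n s ts.1 ts.2).integrableOn hκ0 x)
  beta_reduce at key
  rw [e, key]
  exact Fintype.sum_prod_type' (fun τ σ => conj (f τ) * g σ * latticeKernel (M n s τ σ) x)

/-- [folklore] **THE n-UNIFORM BLOCK-PAIR LOCALISATION OF THE CONSTRAINED INVERSE OF `(Δ^ξ)^s` — FIBRE∕STRIP ROUTE, OPERATOR CURRENCY** (R-FP-29's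
second arrow at U = 𝟙 with the prefactor in the gap half's norm): for EVERY `n ≥ 1`, every order `s`, every block separation `x ∈ ℤ^{d+1}` and all
offset vectors `f, g : {0,…,n−1}^{d+1} → ℂ`,
`‖Σ_{τσ} conj(f τ)·g σ·latticeKernel (M n s τ σ) x‖ ≤ 4^{d+1}·Kop (d+1) s·√(sqNorm f)·√(sqNorm g)·e^{−kappaB (d+1) s·|x|_∞}` —
i.e. the OPERATOR NORM of the block-pair matrix `(latticeKernel (M n s τ σ) x)_{τσ}` is `≤ 4^{d+1}·Kop·e^{−kappaB|x|_∞}` with `Kop`, `kappaB` n-FREE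
(in unit-lattice currency: `× n^{2s}` = `n⁴` for the ghost's bi-Laplacian, the gap half's prefactor). -/
theorem pairing_decay (n : ℕ) [NeZero n] (s : ℕ) (f g : (Fin (d + 1) → Fin n) → ℂ) (x : Fin (d + 1) → ℤ) :
    ‖∑ τ : Fin (d + 1) → Fin n, ∑ σ : Fin (d + 1) → Fin n, conj (f τ) * g σ * latticeKernel (M n s τ σ) x‖
      ≤ 4 ^ (d + 1) * Kop (d + 1) s * (Real.sqrt (sqNorm f) * Real.sqrt (sqNorm g)) * Real.exp (-(kappaB (d + 1) s * supNorm x)) := by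
  rw [← latticeKernel_Phi]
  exact latticeKernel_decay (stripRegular_Phi n s f g) (kappaB_pos (d + 1) s).le x

/-- [folklore] The packaged form: ONE n-free rate `κ > 0` and ONE n-free constant `C ≥ 0` for all `n ≥ 1`, `f`, `g`, `x`.
SIZE OF THE CONSTANTS (v1.1 note, cross-read C-gan24leaf03-g46 INFO-1∕2): the n-UNIFORMITY is the content; the explicit values are
QUALITATIVE — at `(d+1, s) = (4, 2)`, `kappaB ≈ 1.6·10⁻¹⁸` per block and `4^{d+1}·Kop ≈ 6·10²²`, against an empirical mass `≈ 1` per block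
and fibre operator norm `≤ 6.4·10⁻³` (leaf-03-g46's engine); consumers needing `∃ κ > 0, ∃ C` n-free are served, consumers needing NUMBERS
are not (a tail sum `(2∕κ)⁴` would be `≈ 10⁷²`; certified constants are balaban-calc business). -/
theorem pairing_decay_uniform (d s : ℕ) :
    ∃ κ C : ℝ, 0 < κ ∧ 0 ≤ C ∧ ∀ (n : ℕ) [NeZero n] (f g : (Fin (d + 1) → Fin n) → ℂ) (x : Fin (d + 1) → ℤ),
      ‖∑ τ : Fin (d + 1) → Fin n, ∑ σ : Fin (d + 1) → Fin n, conj (f τ) * g σ * latticeKernel (M n s τ σ) x‖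
        ≤ C * (Real.sqrt (sqNorm f) * Real.sqrt (sqNorm g)) * Real.exp (-(κ * supNorm x)) :=
  ⟨kappaB (d + 1) s, 4 ^ (d + 1) * Kop (d + 1) s, kappaB_pos (d + 1) s, by have := Kop_nonneg (d + 1) s; positivity,
    fun n _ f g x => pairing_decay n s f g x⟩

/-- [folklore] The indicator vector of an offset has unit `ℓ²` norm. -/
theorem sqNorm_indicator {ι : Type*} [Fintype ι] [DecidableEq ι] (a : ι) : sqNorm (fun i => if i = a then (1 : ℂ) else 0) = 1 := by
  unfold sqNorm
  have : ∀ i : ι, ‖(if i = a then (1 : ℂ) else 0)‖ ^ 2 = if i = a then 1 else 0 := fun i => by split_ifs <;> simp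
  simp only [this, Finset.sum_ite_eq', Finset.mem_univ, if_true]

/-- [folklore] Pairing against two indicator vectors picks one entry. -/
theorem pairing_indicator {ι : Type*} [Fintype ι] [DecidableEq ι] (K : ι → ι → ℂ) (a b : ι) :
    ∑ τ, ∑ σ, conj ((fun i => if i = a then (1 : ℂ) else 0) τ) * (fun i => if i = b then (1 : ℂ) else 0) σ * K τ σ = K a b := by
  have : ∀ τ σ : ι, conj ((fun i => if i = a then (1 : ℂ) else 0) τ) * (fun i => if i = b then (1 : ℂ) else 0) σ * K τ σ
      = if σ = b then (if τ = a then K τ σ else 0) else 0 := fun τ σ => by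
    split_ifs <;> simp_all
  simp only [this, Finset.sum_ite_eq', Finset.mem_univ, if_true]

/-- [folklore] **ENTRYWISE COROLLARY WITH AN n-FREE CONSTANT** (indicator vectors in `pairing_decay`): for EVERY `n ≥ 1`, all offsets `τ, σ` and
every block separation `x`, `‖latticeKernel (M n s τ σ) x‖ ≤ 4^{d+1}·Kop (d+1) s·e^{−kappaB (d+1) s·|x|_∞}` — in block units even the single
entries are bounded UNIFORMLY IN n (compare FILE 3b's sharper-in-power but `log n`-carrying `boundM`); unit-lattice currency × n^{2s}. -/
theorem entry_decay_uniform (n : ℕ) [NeZero n] (s : ℕ) (τ σ : Fin (d + 1) → Fin n) (x : Fin (d + 1) → ℤ) :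
    ‖latticeKernel (M n s τ σ) x‖ ≤ 4 ^ (d + 1) * Kop (d + 1) s * Real.exp (-(kappaB (d + 1) s * supNorm x)) := by
  have h := pairing_decay n s (fun i => if i = τ then (1 : ℂ) else 0) (fun i => if i = σ then (1 : ℂ) else 0) x
  rw [pairing_indicator (fun τ' σ' => latticeKernel (M n s τ' σ') x) τ σ, sqNorm_indicator, sqNorm_indicator, Real.sqrt_one,
    mul_one, mul_one] at h
  exact h

end Summit.QuantumFields.BalabanUV.Beta.FP.ConstrainedBiLaplacianPairing

end
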